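import Literature.NumberTheory.LFunctions.PrimesInRayClasses
import Literature.NumberTheory.GaloisRepresentations.RayClassIntegralIdeleRepresentative
import Literature.NumberTheory.ComplexMultiplication.CMTypePrimeProductFrobeniusShape
import Mathlib.RingTheory.DedekindDomain.Different
import HarnessLib

/-!
# Totally split degree-one PRIME representatives of an idèle class: `x·(a) = idealIdele(𝔮)·u`, `N𝔮 = q` prime, `𝔮² ∤ (q)`, `u ∈ I_K^𝔪`

Topic `NumberTheory/LFunctions` (consumer of Landau՚s theorem ★ `PrimesInRayClasses.lean`); namespace `Literature.NumberTheory.LFunctions`.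
THEOREMS ONLY (no definition, no instance, no notation, no named fact, no `sorry`).  Cell `hodgecm-mathlib`, crux hLiu418
(`stmt-HodgeConjecture-24832`), organ (S6)∕(S6+) «TWIST DATA — row (d) coprime to its conjugate» (LA5-plan (g3) DEAL L5-#4 → LA7-p02 (g3);
LA5-p02 (g3) (Q3) 2026-09-02T06:03Z: the Serre-cover head needs `𝔞_γ + 𝔞̄_γ = (1)`).  HC_CM is proved only modulo the printed citations until
rung 0 closes; nothing here is about HC.

THE MATHEMATICS.  ★ `RayClassIntegralIdeleRepresentative` (Neukirch VI (1.9)) represents an idèle class modulo `Kˣ` by `idealIdele(𝔟)·u` with `𝔟`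
ANY integral ideal of the right narrow ray class mod `𝔪`.  Landau՚s theorem ([Landau1918Idealklassen] §1 Satz; ★ `exists_rayClassRel_prime_absNorm_not_mem`)
puts into every narrow ray class infinitely many PRIME ideals `𝔮` of degree one (`N𝔮 = q` a rational prime), outside any finite set; excluding moreover
the finitely many primes dividing the different `𝔇_{K∕ℚ}` ([NeukirchANT1999] Ch. III §2 Thm. (2.6): `𝔮 ∣ 𝔇 ⇔ 𝔮` ramified; Mathlib
`pow_sub_one_dvd_differentIdeal`, `differentIdeal_ne_bot`) makes `𝔮` UNRAMIFIED: `𝔮² ∤ (q)` (§1).  For `K ∕ ℚ` Galois such a `𝔮` is TOTALLY SPLIT: its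
decomposition group is trivial, `g•𝔮 = 𝔮 ⇒ g = 1` (§2: `𝔮^{#Stab(𝔮)} ∣ ∏_{g} g•𝔮 = (N𝔮) = (q)`, ★ `GaloisConjugatePrimeProductShape.dvd_of_prod_univ_eq` +
★ `prod_univ_smul_asIdeal_eq_span_absNorm`), so its `#G` conjugates are pairwise distinct — whence, for a CM type `Φ ⊆ Gal(K∕ℚ)`, the type product
`∏_{g∈Φ} g•𝔮` is COPRIME TO ITS CONJUGATE `∏_{g∈Φᶜ} g•𝔮` (the consumer՚s row (d), `Theorems/F0P6aTwistDataCoprime`).  §3 carries this through the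
idèle dictionary exactly as ★ `RayClassIntegralIdeleRepresentative` §1–§2: `(a)·x = idealIdele(𝔮)·u` (`u ∈ I_K^𝔪`), the integral form, and the
finite-idèle form `(s·a) = 𝔮`, `s·a ≡ 1 mod 𝔪` (Cassels՚ «working form», [Cassels1964ArithmeticVI] p. 70: «choose `δ` in its congruence class with
`(…)⁻¹δ` a first-degree prime ideal»).

[cite: Landau1918Idealklassen, §1 Satz] [cite: NeukirchANT1999, Ch. VI §1 Prop. (1.9) pp. 364–365; Ch. III §2 Thm. (2.6)] [cite: Cassels1964ArithmeticVI, p. 70]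
-/

set_option autoImplicit false

noncomputable section

open NumberField IsDedekindDomain IsDedekindDomain.HeightOneSpectrum
open Literature.NumberTheory.GaloisRepresentations
open scoped nonZeroDivisors Pointwise

namespace Literature.NumberTheory.LFunctions

universe u

variable {K : Type u} [Field K] [NumberField K] {𝔪 : Ideal (𝓞 K)}

/-! ## §1 Unramified degree-one primes in a narrow ray class, outside any finite set -/

/-- A prime not containing `𝔪` is prime to `𝔪`. [folklore] -/
private theorem isCoprime_asIdeal_of_not_le' {v : HeightOneSpectrum (𝓞 K)} (hv : ¬ 𝔪 ≤ v.asIdeal) : IsCoprime v.asIdeal 𝔪 := by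
  rw [Ideal.isCoprime_iff_sup_eq]
  exact v.isMaximal.out.2 _ (lt_of_le_of_ne le_sup_left fun e => hv (e ▸ le_sup_right))

/-- **A degree-one prime not dividing the different is unramified: `𝔮² ∤ (N𝔮)`** (`N𝔮 = q` prime; `𝔮² ∣ (q) ⇒ 𝔮 ∣ 𝔇_{K∕ℚ}`, Mathlib
`pow_sub_one_dvd_differentIdeal`). [cite: NeukirchANT1999, Ch. III §2 Thm. (2.6)] -/
theorem not_sq_dvd_span_absNorm_of_not_dvd_differentIdeal {v : HeightOneSpectrum (𝓞 K)} (hq : (Ideal.absNorm v.asIdeal).Prime)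
    (hv : ¬ v.asIdeal ∣ differentIdeal ℤ (𝓞 K)) :
    ¬ v.asIdeal ^ 2 ∣ Ideal.span {((Ideal.absNorm v.asIdeal : ℕ) : 𝓞 K)} := by
  intro h
  apply hv
  haveI : (Ideal.span {((Ideal.absNorm v.asIdeal : ℕ) : ℤ)}).IsMaximal :=
    PrincipalIdealRing.isMaximal_of_irreducible (Nat.prime_iff_prime_int.mp hq).irreducible
  have h' : v.asIdeal ^ 2 ∣ (Ideal.span {((Ideal.absNorm v.asIdeal : ℕ) : ℤ)}).map (algebraMap ℤ (𝓞 K)) := by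
    rwa [Ideal.map_span, Set.image_singleton, map_natCast]
  have h2 := pow_sub_one_dvd_differentIdeal ℤ v.asIdeal 2
    (by rw [Ne, Ideal.span_singleton_eq_bot]; exact_mod_cast hq.ne_zero) h'
  rwa [show 2 - 1 = 1 from rfl, pow_one] at h2

/-- **Landau + unramified: every narrow ray class mod `𝔪 ≠ 0` contains a degree-one UNRAMIFIED prime outside any finite set** — a prime
`𝔮 ∉ S`, `𝔮 ∤ 𝔪`, in the narrow ray class of `𝔟`, with `N𝔮 = q` a rational prime and `𝔮² ∤ (q)` (avoid also the finitely many prime divisors of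
`𝔇_{K∕ℚ} ≠ 0`). [cite: Landau1918Idealklassen, §1 Satz] [cite: NeukirchANT1999, Ch. III §2 Thm. (2.6)] -/
theorem exists_rayClassRel_prime_absNorm_not_sq_dvd (h𝔪 : 𝔪 ≠ ⊥) (𝔟 : CoprimeIdeal 𝔪) (S : Set (HeightOneSpectrum (𝓞 K)))
    (hS : S.Finite) :
    ∃ v : HeightOneSpectrum (𝓞 K), v ∉ S ∧ ¬ 𝔪 ≤ v.asIdeal ∧ RayClassRel 𝔪 𝔟.1 v.asIdeal ∧ (Ideal.absNorm v.asIdeal).Prime ∧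
      ¬ v.asIdeal ^ 2 ∣ Ideal.span {((Ideal.absNorm v.asIdeal : ℕ) : 𝓞 K)} := by
  have hT : {v : HeightOneSpectrum (𝓞 K) | v.asIdeal ∣ differentIdeal ℤ (𝓞 K)}.Finite := Ideal.finite_factors differentIdeal_ne_bot
  obtain ⟨v, hvS, hv𝔪, hrel, hq⟩ := exists_rayClassRel_prime_absNorm_not_mem h𝔪 𝔟 _ (hS.union hT)
  rw [Set.mem_union, not_or] at hvS
  exact ⟨v, hvS.1, hv𝔪, hrel, hq, not_sq_dvd_span_absNorm_of_not_dvd_differentIdeal hq hvS.2⟩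

/-! ## §2 `K ∕ ℚ` Galois: an unramified degree-one prime is totally split (trivial decomposition group) -/

/-- **`𝔮² ∤ (N𝔮)` ⇒ the stabiliser of `𝔮` in `Gal(K∕ℚ)` is trivial** (`𝔮^{#Stab 𝔮} ∣ ∏_{g ∈ G} g•𝔮 = (N𝔮)`, ★ `dvd_of_prod_univ_eq` + ★
`prod_univ_smul_asIdeal_eq_span_absNorm`; two distinct elements of the stabiliser would give `𝔮² ∣ (N𝔮)`).
[cite: NeukirchANT1999, Ch. I §9 and Ch. III §1 (1.6) Prop. (iv)] -/
theorem eq_one_of_smul_eq_of_not_sq_dvd_span_absNorm [IsGalois ℚ K] {v : HeightOneSpectrum (𝓞 K)}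
    (h2 : ¬ v.asIdeal ^ 2 ∣ Ideal.span {((Ideal.absNorm v.asIdeal : ℕ) : 𝓞 K)}) (g : K ≃ₐ[ℚ] K) (hg : g • v = v) : g = 1 := by
  classical
  by_contra hne
  obtain ⟨hdvd, -, -⟩ := Literature.NumberTheory.NumberFields.dvd_of_prod_univ_eq (Finset.univ : Finset (K ≃ₐ[ℚ] K)) v
    (fun g _ => Finset.mem_univ g) (Literature.NumberTheory.ComplexMultiplication.prod_univ_smul_asIdeal_eq_span_absNorm v)
  have hcard : 2 ≤ (Finset.univ.filter fun g : K ≃ₐ[ℚ] K => g • v = v).card :=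
    Finset.one_lt_card.mpr ⟨1, by simp, g, by simp [hg], fun h => hne h.symm⟩
  exact h2 ((pow_dvd_pow v.asIdeal hcard).trans hdvd)

/-- **The conjugates of a totally split prime are pairwise distinct**: `g•𝔮 = h•𝔮 ⇒ g = h`. [cite: NeukirchANT1999, Ch. I §9] -/
theorem smul_injective_of_not_sq_dvd_span_absNorm [IsGalois ℚ K] {v : HeightOneSpectrum (𝓞 K)}
    (h2 : ¬ v.asIdeal ^ 2 ∣ Ideal.span {((Ideal.absNorm v.asIdeal : ℕ) : 𝓞 K)}) :
    Function.Injective fun g : K ≃ₐ[ℚ] K => g • v := by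
  intro g h hgh
  have h1 : (h⁻¹ * g) • v = v := by
    have hgh' : g • v = h • v := hgh
    rw [mul_smul, hgh', inv_smul_smul]
  have := eq_one_of_smul_eq_of_not_sq_dvd_span_absNorm h2 (h⁻¹ * g) h1
  rw [inv_mul_eq_one] at this
  exact this.symm

/-! ## §3 Idèles: `(a)·x = idealIdele(𝔮)·u` with `𝔮` a totally split degree-one prime outside `S`, `u ∈ I_K^𝔪` -/

/-- **Neukirch VI (1.9) for a PRESCRIBED integral representative**: if the integral ideal `𝔟` prime to `𝔪` lies in the narrow ray class of the idèle
`x` (`integralRayClass 𝔟 = rayClassOfIdele x`), then `(a)·x = idealIdele(𝔟)·u` for some `a ∈ Kˣ`, `u ∈ I_K^𝔪`.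
[cite: NeukirchANT1999, Ch. VI §1 Prop. (1.9) (with proof) pp. 364–365] -/
theorem exists_principalIdele_mul_eq_idealIdele_mul_of_integralRayClass_eq (h𝔪 : 𝔪 ≠ ⊥) (x : ideleGroup K) (𝔟 : CoprimeIdeal 𝔪)
    (h : integralRayClass 𝔪 h𝔪 𝔟 = rayClassOfIdele h𝔪 x) :
    ∃ (a : Kˣ) (u : ideleGroup K), u ∈ congruenceUnitIdeles 𝔪 ∧
      principalIdele K a * x = idealIdele (Units.mk0 (𝔟.1 : FractionalIdeal (𝓞 K)⁰ K) (FractionalIdeal.coeIdeal_ne_zero.mpr 𝔟.2.1)) * u := by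
  set B : (FractionalIdeal (𝓞 K)⁰ K)ˣ :=
    Units.mk0 (𝔟.1 : FractionalIdeal (𝓞 K)⁰ K) (FractionalIdeal.coeIdeal_ne_zero.mpr 𝔟.2.1) with hB_def
  have hB : B ∈ idealsPrimeTo 𝔪 := unitsMk0_coeIdeal_mem_idealsPrimeTo h𝔪 𝔟.2.1 𝔟.2.2
  have h1 : rayClassOfIdele h𝔪 (idealIdele B) = rayClassOfIdele h𝔪 x := by
    rw [rayClassOfIdele_idealIdele h𝔪 hB, ← h]
    rfl
  have h2 : x⁻¹ * idealIdele B ∈ (rayClassOfIdele h𝔪).ker := by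
    rw [MonoidHom.mem_ker, map_mul, map_inv, h1, inv_mul_cancel]
  rw [ker_rayClassOfIdele h𝔪] at h2
  obtain ⟨p, hp, u, hu, hpu⟩ := Subgroup.mem_sup.mp h2
  obtain ⟨a, rfl⟩ := hp
  refine ⟨a, u⁻¹, inv_mem hu, ?_⟩
  have e1 : principalIdele K a = x⁻¹ * idealIdele B * u⁻¹ := by
    rw [← hpu, mul_inv_cancel_right]
    rfl
  rw [e1, mul_comm, ← mul_assoc, ← mul_assoc, mul_inv_cancel, one_mul]

/-- **Every idèle class modulo `Kˣ` is represented by `idealIdele(𝔮)·u` with `𝔮` A TOTALLY SPLIT DEGREE-ONE PRIME outside any finite set `S`**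
(`𝔮 ∤ 𝔪`, `N𝔮 = q` prime, `𝔮² ∤ (q)`) and `u ∈ I_K^𝔪`: Landau՚s prime in the narrow ray class of `x` (§1), then (1.9).
[cite: Landau1918Idealklassen, §1 Satz] [cite: NeukirchANT1999, Ch. VI §1 Prop. (1.9) pp. 364–365] -/
theorem exists_principalIdele_mul_eq_idealIdele_prime_mul (h𝔪 : 𝔪 ≠ ⊥) (x : ideleGroup K) (S : Set (HeightOneSpectrum (𝓞 K)))
    (hS : S.Finite) :
    ∃ (a : Kˣ) (v : HeightOneSpectrum (𝓞 K)) (u : ideleGroup K), v ∉ S ∧ ¬ 𝔪 ≤ v.asIdeal ∧ (Ideal.absNorm v.asIdeal).Prime ∧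
      ¬ v.asIdeal ^ 2 ∣ Ideal.span {((Ideal.absNorm v.asIdeal : ℕ) : 𝓞 K)} ∧ u ∈ congruenceUnitIdeles 𝔪 ∧
      principalIdele K a * x =
        idealIdele (Units.mk0 (v.asIdeal : FractionalIdeal (𝓞 K)⁰ K) (FractionalIdeal.coeIdeal_ne_zero.mpr v.ne_bot)) * u := by
  obtain ⟨𝔟₀, h𝔟₀⟩ := integralRayClass_surjective (𝔪 := 𝔪) h𝔪 (rayClassOfIdele h𝔪 x)
  obtain ⟨v, hvS, hv𝔪, hrel, hq, h2⟩ := exists_rayClassRel_prime_absNorm_not_sq_dvd h𝔪 𝔟₀ S hS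
  set 𝔮 : CoprimeIdeal 𝔪 := ⟨v.asIdeal, v.ne_bot, isCoprime_asIdeal_of_not_le' hv𝔪⟩ with h𝔮
  have hcl : integralRayClass 𝔪 h𝔪 𝔮 = rayClassOfIdele h𝔪 x :=
    ((integralRayClass_eq_iff h𝔪 𝔮 𝔟₀).mpr hrel).symm.trans h𝔟₀
  obtain ⟨a, u, hu, hx⟩ := exists_principalIdele_mul_eq_idealIdele_mul_of_integralRayClass_eq h𝔪 x 𝔮 hcl
  exact ⟨a, v, u, hvS, hv𝔪, hq, h2, hu, hx⟩

/-- **Totally split prime representative, integral form**: `(a)·x ∈ I_K^{(𝔪)}` with ideal `((a)·x) = 𝔮` a totally split degree-one prime `∉ S`,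
`𝔮 ∤ 𝔪`. [cite: Landau1918Idealklassen, §1 Satz] [cite: NeukirchANT1999, Ch. VI §1 Prop. (1.9) pp. 364–365] -/
theorem exists_principalIdele_mul_prime (h𝔪 : 𝔪 ≠ ⊥) (x : ideleGroup K) (S : Set (HeightOneSpectrum (𝓞 K))) (hS : S.Finite) :
    ∃ (a : Kˣ) (v : HeightOneSpectrum (𝓞 K)), v ∉ S ∧ ¬ 𝔪 ≤ v.asIdeal ∧ (Ideal.absNorm v.asIdeal).Prime ∧
      ¬ v.asIdeal ^ 2 ∣ Ideal.span {((Ideal.absNorm v.asIdeal : ℕ) : 𝓞 K)} ∧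
      principalIdele K a * x ∈ congruenceIdeles 𝔪 ∧
      ((ideleIdeal (principalIdele K a * x) : (FractionalIdeal (𝓞 K)⁰ K)ˣ) : FractionalIdeal (𝓞 K)⁰ K) = v.asIdeal := by
  obtain ⟨a, v, u, hvS, hv𝔪, hq, h2, hu, hx⟩ := exists_principalIdele_mul_eq_idealIdele_prime_mul h𝔪 x S hS
  have hB : Units.mk0 (v.asIdeal : FractionalIdeal (𝓞 K)⁰ K) (FractionalIdeal.coeIdeal_ne_zero.mpr v.ne_bot) ∈ idealsPrimeTo 𝔪 :=
    unitsMk0_coeIdeal_mem_idealsPrimeTo h𝔪 v.ne_bot (isCoprime_asIdeal_of_not_le' hv𝔪)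
  refine ⟨a, v, hvS, hv𝔪, hq, h2, ?_, ?_⟩
  · rw [hx]
    exact mul_mem (idealIdele_mem_congruenceIdeles h𝔪 hB) (congruenceUnitIdeles_le_congruenceIdeles hu)
  · rw [hx, ideleIdeal_mul, ideleIdeal_idealIdele,
      ideleIdeal_eq_one_iff_mem_unitIdeles.mpr (congruenceUnitIdeles_le_unitIdeles hu), mul_one, Units.val_mk0]

/-- **Totally split prime representative of a FINITE idèle modulo `Kˣ`** (Cassels՚ working form): for `s ∈ 𝔸_{K,f}^×`, `𝔪 ≠ 0` and a finite set `S`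
of primes there is `a ∈ Kˣ` with `(s·a) = 𝔮` a degree-one prime `∉ S`, `𝔮 ∤ 𝔪`, `N𝔮 = q` prime, `𝔮² ∤ (q)`, and `|s_v a|_v = 1`, `|s_v a − 1|_v ≤ q_v^{-n_v}` at
every prime `v` of `𝔪`. [cite: Cassels1964ArithmeticVI, p. 70] [cite: Landau1918Idealklassen, §1 Satz] [cite: NeukirchANT1999, Ch. VI §1 Prop. (1.9) pp. 364–365] -/
theorem exists_mul_unitEmbedding_prime_congr (h𝔪 : 𝔪 ≠ ⊥) (s : (FiniteAdeleRing (𝓞 K) K)ˣ) (S : Set (HeightOneSpectrum (𝓞 K)))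
    (hS : S.Finite) :
    ∃ (a : Kˣ) (v : HeightOneSpectrum (𝓞 K)), v ∉ S ∧ ¬ 𝔪 ≤ v.asIdeal ∧ (Ideal.absNorm v.asIdeal).Prime ∧
      ¬ v.asIdeal ^ 2 ∣ Ideal.span {((Ideal.absNorm v.asIdeal : ℕ) : 𝓞 K)} ∧
      Automorphic.FiniteAdeleRing.toFractionalIdeal (𝓞 K) K (s * FiniteAdeleRing.unitEmbedding (𝓞 K) K a) =
        (v.asIdeal : FractionalIdeal (𝓞 K)⁰ K) ∧
      ∀ v' : HeightOneSpectrum (𝓞 K), 𝔪 ≤ v'.asIdeal →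
        Valued.v (((s * FiniteAdeleRing.unitEmbedding (𝓞 K) K a : (FiniteAdeleRing (𝓞 K) K)ˣ) :
            FiniteAdeleRing (𝓞 K) K) v') = 1 ∧
        Valued.v (((s * FiniteAdeleRing.unitEmbedding (𝓞 K) K a : (FiniteAdeleRing (𝓞 K) K)ˣ) :
            FiniteAdeleRing (𝓞 K) K) v' - 1) ≤ WithZero.exp (-(modulusExp 𝔪 v' : ℤ)) := by
  set x : ideleGroup K :=
    Units.map ((MonoidHom.inr (InfiniteAdeleRing K) (FiniteAdeleRing (𝓞 K) K) :
      FiniteAdeleRing (𝓞 K) K →* AdeleRing (𝓞 K) K)) s with hx_def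
  obtain ⟨a, v, hvS, hv𝔪, hq, h2, hcong, hideal⟩ := exists_principalIdele_mul_prime h𝔪 x S hS
  have hfin : ideleGroup.finPart K (principalIdele K a * x) = s * FiniteAdeleRing.unitEmbedding (𝓞 K) K a := by
    rw [map_mul, mul_comm]
    congr 1
  have hcomp : ∀ v' : HeightOneSpectrum (𝓞 K),
      ((s * FiniteAdeleRing.unitEmbedding (𝓞 K) K a : (FiniteAdeleRing (𝓞 K) K)ˣ) : FiniteAdeleRing (𝓞 K) K) v' =
        ((principalIdele K a * x : ideleGroup K) : AdeleRing (𝓞 K) K).2 v' := fun v' => by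
    rw [← ideleGroup.val_finPart_apply, hfin]
  refine ⟨a, v, hvS, hv𝔪, hq, h2, ?_, fun v' hv' => ?_⟩
  · rw [← hfin, ← hideal]
    rfl
  · have hn : modulusExp 𝔪 v' ≠ 0 := (modulusExp_ne_zero_iff 𝔪 h𝔪 v').mpr hv'
    refine ⟨?_, ?_⟩
    · rw [hcomp, valued_snd_eq_exp_neg_ideleOrd, ideleOrd_eq_zero_of_mem_congruenceIdeles h𝔪 hcong hv', neg_zero,
        WithZero.exp_zero]
    · rw [hcomp]
      exact hcong.1 v' hn

end Literature.NumberTheory.LFunctions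

end
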